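import Literature.Geometry.GaugeTheory.AdaptedFramesTraceHessian
import Literature.Geometry.GaugeTheory.SelfDualCurvaturePerturbation
import HarnessLib

/-!
# The divergence of a 1-form as an exact form on an almost-Kähler `4`-manifold:
# `d(θ ∘ J)(e₀, e₁) + d(θ ∘ J)(e₂, e₃) = -Σ_k (∇_{e_k}θ)(e_k)` in a unitary frame

Topic `Literature/Geometry/GaugeTheory`; generalises `AdaptedFramesTraceHessian` (the case `θ = df`)
from differentials to arbitrary smooth real 1-forms `θ`.  On an almost-Hermitian `4`-manifold
`⋆θ = (θ ∘ J) ∧ ω` for 1-forms, so when `dω = 0` the divergence `div θ = -δθ = ⋆d⋆θ` satisfies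
`(div θ)·ω²/2 = d((θ∘J) ∧ ω) = d(θ∘J) ∧ ω`: in a unitary frame `e` (`Je₀ = e₁`, `Je₂ = e₃`),

  `d(θ∘J)(e₀,e₁) + d(θ∘J)(e₂,e₃) = -Σ_k (e_k(θ(e_k)) - θ(∇_{e_k}e_k)) = -Σ_k (∇_{e_k}θ)(e_k)`,

the `∇J`-terms cancelling by the quasi-Kähler identity exactly as for `df`
(`sum_frameChristoffel_diag_eq`).  Integrated against `ω ∧ ω` this is the divergence theorem
`∫ div θ = 0` on a closed symplectic `4`-manifold (`Symplectic/SymplecticDivergenceIntegral`), the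
integration by parts behind the formal adjoints of `d`, `∇_A` and `D_A` used throughout Taubes 1994,
§§2–3.

* `jPrecomp J θ = θ ∘ J`, smooth where `θ` is (`smoothAt_jPrecomp`);
* **`mextDeriv_jPrecomp_frame_sum`**: the displayed identity.

PROVED, 0 named facts.

## References

* M. Falcitelli, S. Ianus, A. M. Pastore, *Riemannian Submersions and Related Topics* (2004),
  Ch. 3 §3.1 (`δ` on almost-Hermitian manifolds, quasi-Kähler identity). [FalcitelliPastoreIanus2004]
* F. W. Warner, *Foundations of Differentiable Manifolds and Lie Groups*, GTM 94 (1983),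
  Prop. 2.25(f), 6.1–6.2. [WarnerGTM94]
* C. H. Taubes, *The Seiberg–Witten invariants and symplectic forms*, Math. Res. Lett. 1 (1994)
  809–822, §§2–3. [Taubes1994]
-/

noncomputable section

open scoped Manifold ContDiff Topology Bundle
open Set Function Filter Bundle VectorField
open Literature.Geometry.Lorentzian (PseudoRiemannianMetric contMDiffAt_clm_apply_iff)
open Literature.Topology.FourManifolds (SmoothOrientation)
open Literature.Geometry.Kaehler (MForm IsSmoothForm mextDeriv)
open Literature.Geometry.Symplectic (AlmostComplexStructure)

namespace Literature.Geometry.GaugeTheory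

/-! ### The 1-form `θ ∘ J` -/

section JPrecomp

variable {X : Type*} [TopologicalSpace X] [ChartedSpace (EuclideanSpace ℝ (Fin 4)) X] [IsManifold (𝓡 4) ∞ X]
  (J : AlmostComplexStructure (𝓡 4) ∞ X)

/-- **The real 1-form `θ ∘ J`**: `v ↦ θ(Jv)` (for `θ = df` this is `jGradForm`; `⋆θ = (θ ∘ J) ∧ ω` in
real dimension `4`). [cite: WarnerGTM94, 6.1] -/
def jPrecomp (θ : RealOneForm X) : RealOneForm X := fun x ↦ (θ x).comp (J x)

/-- `(θ ∘ J)(v) = θ(Jv)`. [folklore] -/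
@[simp] theorem jPrecomp_apply (θ : RealOneForm X) (x : X) (v : TangentSpace (𝓡 4) x) :
    jPrecomp J θ x v = θ x (J x v) := rfl

/-- `df ∘ J` is `jGradForm`. [folklore] -/
theorem jPrecomp_mvfderiv (f : X → ℝ) : jPrecomp J (fun x ↦ mvfderiv (𝓡 4) f x) = jGradForm J f := rfl

/-- **The covector field `w ↦ θ(J e.symmL w)` is smooth at `x₀`** for `θ` smooth at `x₀` (a smooth form
on the smooth field `x ↦ J_x(e.symmL x w)`). [folklore] -/
theorem contMDiffAt_jPrecomp_comp_symmL {θ : RealOneForm X} {x₀ : X} (hθ : θ.SmoothAt x₀) :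
    ContMDiffAt (𝓡 4) 𝓘(ℝ, EuclideanSpace ℝ (Fin 4) →L[ℝ] ℝ) ∞ (fun x ↦ (jPrecomp J θ x).comp
      ((trivializationAt (EuclideanSpace ℝ (Fin 4)) (TangentSpace (𝓡 4) : X → Type _) x₀).symmL ℝ x)) x₀ := by
  rw [contMDiffAt_clm_apply_iff]
  intro w
  have hW := Literature.Geometry.Symplectic.AlmostComplexStructure.IsCompatibleWith.contMDiffAt_map_field J
    (contMDiffAt_symmL_trivializationAt x₀ w)
  have h := smoothAt_apply_sections (α := θ.toMForm) hθ
    (V := ![fun x ↦ J x ((trivializationAt (EuclideanSpace ℝ (Fin 4)) (TangentSpace (𝓡 4) : X → Type _) x₀).symmL ℝ x w)])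
    (fun j ↦ by fin_cases j; exact hW)
  refine h.congr_of_eventuallyEq (Eventually.of_forall fun y ↦ ?_)
  simp [RealOneForm.toMForm_apply]

/-- **`θ ∘ J` is smooth at `x₀`** for `θ` smooth at `x₀`. [folklore] -/
theorem smoothAt_jPrecomp {θ : RealOneForm X} {x₀ : X} (hθ : θ.SmoothAt x₀) : (jPrecomp J θ).SmoothAt x₀ := by
  obtain ⟨F, hF⟩ : ∃ F : X → EuclideanSpace ℝ (Fin 4) →L[ℝ] ℝ, F = fun x ↦ (jPrecomp J θ x).comp
      ((trivializationAt (EuclideanSpace ℝ (Fin 4)) (TangentSpace (𝓡 4) : X → Type _) x₀).symmL ℝ x) := ⟨_, rfl⟩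
  have hFs : ContMDiffAt (𝓡 4) 𝓘(ℝ, EuclideanSpace ℝ (Fin 4) →L[ℝ] ℝ) ∞ F x₀ := hF ▸ contMDiffAt_jPrecomp_comp_symmL J hθ
  have hG : ContMDiffAt (𝓡 4) 𝓘(ℝ, (EuclideanSpace ℝ (Fin 4)) [⋀^Fin 1]→L[ℝ] ℝ) ∞
      ((fun L : EuclideanSpace ℝ (Fin 4) →L[ℝ] ℝ ↦
        ContinuousAlternatingMap.ofSubsingleton ℝ (EuclideanSpace ℝ (Fin 4)) ℝ (0 : Fin 1) L) ∘ F) x₀ :=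
    (ContinuousAlternatingMap.ofSubsingletonLIE (𝕜 := ℝ) (E := EuclideanSpace ℝ (Fin 4)) (F := ℝ)
      (0 : Fin 1)).toContinuousLinearEquiv.contDiff.comp_contMDiffAt hFs
  have hG' : ContDiffWithinAt ℝ ∞
      (((fun L : EuclideanSpace ℝ (Fin 4) →L[ℝ] ℝ ↦
        ContinuousAlternatingMap.ofSubsingleton ℝ (EuclideanSpace ℝ (Fin 4)) ℝ (0 : Fin 1) L) ∘ F) ∘
        (extChartAt (𝓡 4) x₀).symm) (range (𝓡 4)) (extChartAt (𝓡 4) x₀ x₀) := by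
    simpa using (contMDiffAt_iff.1 hG).2
  have hev : ∀ y ∈ (extChartAt (𝓡 4) x₀).target, (jPrecomp J θ).toMForm.inChart x₀ y =
      ContinuousAlternatingMap.ofSubsingleton ℝ (EuclideanSpace ℝ (Fin 4)) ℝ (0 : Fin 1) (F ((extChartAt (𝓡 4) x₀).symm y)) := by
    intro y hy
    have hx : (extChartAt (𝓡 4) x₀).symm y ∈ (chartAt (EuclideanSpace ℝ (Fin 4)) x₀).source := by
      rw [← extChartAt_source (𝓡 4)]
      exact (extChartAt (𝓡 4) x₀).map_target hy
    have hD : mfderivWithin 𝓘(ℝ, EuclideanSpace ℝ (Fin 4)) (𝓡 4) (extChartAt (𝓡 4) x₀).symm (range (𝓡 4)) y =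
        (trivializationAt (EuclideanSpace ℝ (Fin 4)) (TangentSpace (𝓡 4) : X → Type _) x₀).symmL ℝ
          ((extChartAt (𝓡 4) x₀).symm y) := by
      rw [TangentBundle.symmL_trivializationAt hx, (extChartAt (𝓡 4) x₀).right_inv hy]
    ext v
    rw [Literature.Geometry.Kaehler.MForm.inChart_apply, hD, ContinuousAlternatingMap.ofSubsingleton_apply_apply]
    simp only [hF, RealOneForm.toMForm_apply, ContinuousLinearMap.comp_apply]
    rfl
  unfold RealOneForm.SmoothAt
  refine hG'.congr_of_eventuallyEq ?_ (hev _ (mem_extChartAt_target x₀))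
  filter_upwards [extChartAt_target_mem_nhdsWithin x₀] with y hy using hev y hy

end JPrecomp

/-! ### The divergence identity in an adapted frame -/

namespace AdaptedFrames

variable {X : Type*} [TopologicalSpace X] [ChartedSpace (EuclideanSpace ℝ (Fin 4)) X] [IsManifold (𝓡 4) ∞ X]
  {g : PseudoRiemannianMetric (𝓡 4) ∞ (EuclideanSpace ℝ (Fin 4)) (TangentSpace (𝓡 4) : X → Type _)}
  {o : SmoothOrientation (𝓡 4) X} {J : AlmostComplexStructure (𝓡 4) ∞ X} {ι : Type*}
  (𝔞 : AdaptedFrames g o (fun x ↦ ((J x : TangentSpace (𝓡 4) x →L[ℝ] TangentSpace (𝓡 4) x) :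
    TangentSpace (𝓡 4) x →ₗ[ℝ] TangentSpace (𝓡 4) x)) ι) [g.HasLeviCivita]

/-- **The frame divergence `Σ_k (∇_{e_k}θ)(e_k) = Σ_k (e_k(θ(e_k)) - θ(∇_{e_k}e_k))`** of a real 1-form
in the frame of the chart `i` at `x` (`= -δθ = div θ^♯`; for `θ = df` it is `Σ_k Hess f(e_k, e_k)`).
[cite: WarnerGTM94, 6.1] -/
def frameDivergence (θ : RealOneForm X) (i : ι) (x : X) : ℝ :=
  ∑ k, (mvfderiv (𝓡 4) (fun y ↦ θ y (𝔞.frame i k y)) x (𝔞.frame i k x) -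
    θ x (g.leviCivita (𝔞.frame i k) x (𝔞.frame i k x)))

/-- Unfolding `frameDivergence`. [folklore] -/
theorem frameDivergence_apply (θ : RealOneForm X) (i : ι) (x : X) :
    𝔞.frameDivergence θ i x = ∑ k, (mvfderiv (𝓡 4) (fun y ↦ θ y (𝔞.frame i k y)) x (𝔞.frame i k x) -
      θ x (g.leviCivita (𝔞.frame i k) x (𝔞.frame i k x))) :=
  rfl

/-- For `θ = df` the frame divergence is the trace of the frame Hessian. [cite: ONeill1983, Ch. 3, Def. 3.48] -/
theorem frameDivergence_mvfderiv (f : X → ℝ) (i : ι) (x : X) :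
    𝔞.frameDivergence (fun y ↦ mvfderiv (𝓡 4) f y) i x = ∑ k, g.hessianAux f (𝔞.frame i k) (𝔞.frame i k) x :=
  rfl

omit [g.HasLeviCivita] in
/-- `y ↦ θ_y(e_b(y))` is differentiable at the points of the chart, for `θ` smooth there. [folklore] -/
theorem mdifferentiableAt_apply_frame {θ : RealOneForm X} (i : ι) (b : Fin 4) {x : X} (hx : x ∈ 𝔞.baseSet i)
    (hθ : θ.SmoothAt x) :
    MDifferentiableAt (𝓡 4) 𝓘(ℝ, ℝ) (fun y ↦ θ y (𝔞.frame i b y)) x :=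
  Literature.Geometry.Kaehler.MForm.mdifferentiableAt_apply_vectorField (α := θ.toMForm) hθ.differentiableWithinAt
    (𝔞.mdifferentiableAt_frame i b hx)

omit [g.HasLeviCivita] in
/-- **`(θ ∘ J)(e_b) = ε_b · θ(e_{κb})` near a point of the chart** (`J e_b = ε_b e_{κb}`). [folklore] -/
theorem jPrecomp_frame_eventuallyEq (θ : RealOneForm X) (i : ι) (b : Fin 4) {x : X} (hx : x ∈ 𝔞.baseSet i) :
    (fun y ↦ (jPrecomp J θ).toMForm y ![𝔞.frame i b y]) =ᶠ[𝓝 x]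
      fun y ↦ jSgn b * θ y (𝔞.frame i (jIdx b) y) := by
  filter_upwards [(𝔞.isOpen_baseSet i).mem_nhds hx] with y hy
  have h := 𝔞.map_frame i hy b
  rw [ContinuousLinearMap.coe_coe] at h
  rw [RealOneForm.toMForm_apply, Matrix.cons_val_zero, jPrecomp_apply, h, map_smul, smul_eq_mul]

/-- **The divergence of a 1-form in a unitary frame is the `ω`-component of the exact form `d(θ ∘ J)`**:
on an adapted chart of `(X, g, J)` with `s(u, v) = g(Ju, v)` smooth and closed (almost-Kähler), for a
real 1-form `θ` smooth near `x ∈ U_i`,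
`d(θ∘J)(e₀, e₁) + d(θ∘J)(e₂, e₃) = -Σ_k (e_k(θ(e_k)) - θ(∇_{e_k}e_k))`.
Warner's formula on the frame fields, `(θ∘J)(e_b) = ε_b θ(e_{κb})`, `[e_a,e_b] = ∇_{e_a}e_b - ∇_{e_b}e_a`,
and `J([e₀,e₁] + [e₂,e₃]) = -Σ_k ∇_{e_k}e_k` (quasi-Kähler). [cite: FalcitelliPastoreIanus2004, Ch. 3 §3.1] -/
theorem mextDeriv_jPrecomp_frame_sum (i : ι) {x : X} (hx : x ∈ 𝔞.baseSet i)
    (s : MForm (𝓡 4) X ℝ 2) (hsm : IsSmoothForm s) (hcl : Literature.Geometry.Kaehler.IsClosedForm s)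
    (hsJ : ∀ y ∈ 𝔞.baseSet i, ∀ v w : TangentSpace (𝓡 4) y, s y ![v, w] = g.val y (J y v) w)
    {θ : RealOneForm X} (hθ : ∀ y ∈ 𝔞.baseSet i, θ.SmoothAt y) :
    mextDeriv (jPrecomp J θ).toMForm x ![𝔞.frame i 0 x, 𝔞.frame i 1 x] +
        mextDeriv (jPrecomp J θ).toMForm x ![𝔞.frame i 2 x, 𝔞.frame i 3 x] =
      -𝔞.frameDivergence θ i x := by
  have hα : DifferentiableWithinAt ℝ ((jPrecomp J θ).toMForm.inChart x) (range (𝓡 4)) (extChartAt (𝓡 4) x x) :=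
    (smoothAt_jPrecomp J (hθ x hx)).differentiableWithinAt
  have hsJ' : ∀ y ∈ 𝔞.baseSet i, ∀ v w : TangentSpace (𝓡 4) y, s y ![v, w] =
      g.val y ((((J y : TangentSpace (𝓡 4) y →L[ℝ] TangentSpace (𝓡 4) y) :
        TangentSpace (𝓡 4) y →ₗ[ℝ] TangentSpace (𝓡 4) y)) v) w := fun y hy v w ↦ by
    rw [ContinuousLinearMap.coe_coe]
    exact hsJ y hy v w
  -- Warner's formula on the frame fields
  have hd : ∀ a b : Fin 4, mextDeriv (jPrecomp J θ).toMForm x ![𝔞.frame i a x, 𝔞.frame i b x] =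
      jSgn b * mvfderiv (𝓡 4) (fun y ↦ θ y (𝔞.frame i (jIdx b) y)) x (𝔞.frame i a x)
        - jSgn a * mvfderiv (𝓡 4) (fun y ↦ θ y (𝔞.frame i (jIdx a) y)) x (𝔞.frame i b x)
        - θ x (J x (g.leviCivita (𝔞.frame i b) x (𝔞.frame i a x) - g.leviCivita (𝔞.frame i a) x (𝔞.frame i b x))) := by
    intro a b
    rw [Literature.Geometry.Kaehler.mextDeriv_apply_vectorField (I := 𝓡 4) (F := ℝ) hα
        (Y₀ := 𝔞.frame i a) (Y₁ := 𝔞.frame i b) (𝔞.mdifferentiableAt_frame i a hx) (𝔞.mdifferentiableAt_frame i b hx),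
      Literature.Geometry.Lorentzian.mvfderiv_congr_nhds (𝔞.jPrecomp_frame_eventuallyEq θ i b hx),
      Literature.Geometry.Lorentzian.mvfderiv_congr_nhds (𝔞.jPrecomp_frame_eventuallyEq θ i a hx),
      mvfderiv_const_mul_apply (𝔞.mdifferentiableAt_apply_frame i (jIdx b) hx (hθ x hx)),
      mvfderiv_const_mul_apply (𝔞.mdifferentiableAt_apply_frame i (jIdx a) hx (hθ x hx)),
      RealOneForm.toMForm_apply, Matrix.cons_val_zero, jPrecomp_apply, 𝔞.mlieBracket_frame_eq i hx]
  -- the quasi-Kähler cancellation: `J(∇₀e₁ - ∇₁e₀ + ∇₂e₃ - ∇₃e₂) = -Σ_k ∇_{e_k} e_k`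
  have hiii := 𝔞.covJCoeffOf_frameChristoffel_cyclic i hx s hsm hcl hsJ'
  have hV : J x (g.leviCivita (𝔞.frame i 1) x (𝔞.frame i 0 x) - g.leviCivita (𝔞.frame i 0) x (𝔞.frame i 1 x)) +
      J x (g.leviCivita (𝔞.frame i 3) x (𝔞.frame i 2 x) - g.leviCivita (𝔞.frame i 2) x (𝔞.frame i 3 x)) =
      -∑ k, g.leviCivita (𝔞.frame i k) x (𝔞.frame i k x) := by
    refine 𝔞.eq_of_val_frame_eq i hx fun c ↦ ?_
    have hC := sum_frameChristoffel_diag_eq (𝔞.frameChristoffel i x) hiii c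
    simp only [frameChristoffel_apply] at hC
    have hvm := fun u ↦ 𝔞.val_map_frame i hx u c
    simp only [ContinuousLinearMap.coe_coe] at hvm
    rw [map_add, add_apply, hvm, hvm, map_sub, sub_apply, map_sub, sub_apply, map_neg, neg_apply, map_sum, sum_apply, hC]
    ring
  -- assemble
  have hdf := congr_arg (θ x) hV
  rw [map_add, map_neg, map_sum] at hdf
  rw [hd 0 1, hd 2 3, frameDivergence_apply]
  simp only [jIdx, jSgn, Matrix.cons_val_zero, Matrix.cons_val_one, Matrix.cons_val, Fin.sum_univ_four, map_sub] at hdf ⊢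
  norm_num at hdf ⊢
  linarith [hdf]

end AdaptedFrames

end Literature.Geometry.GaugeTheory

end
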